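import Mathlib
import Summits.NavierStokesRegularity.NavierStokesRegularity.Theorems.EulerZoomLiouvillePowerGaugeEulerLiouvilleSelfSimilarEndpointDecayFlux
import Summits.NavierStokesRegularity.NavierStokesRegularity.Theorems.EulerZoomLiouvillePowerGaugeEulerLiouvilleSelfSimilarEndpointShellSpread
import Summits.NavierStokesRegularity.NavierStokesRegularity.Theorems.EulerZoomLiouvillePowerGaugeEulerLiouvilleSelfSimilarPastProfileEquations
import HarnessLib

/-!
# Rung C1 of the crux `EulerZoomLiouville.PowerGaugeEulerLiouville` at the endpoint `ρ = 1/2` (weak class):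
# the shell-spread / power-spread strata for members self-similar about `(T, x₀)` on a PAST SUB-SLAB

Route №10 `EulerZoomLiouville` (NavierStokesRegularity), crux E = stmt-NavierStokesRegularity-19832,
registered open stubs `stub_selfSimilarWeakRest` / `stub_nonSelfSimilarRest`.  The endpoint strata of
the tree (`selfSimilar_half_ae_eq_zero_of_powerSpread'`, Chae–Shvydkoy's Thm 3.1 in the class;
`EndpointSpread.selfSimilar_half_ae_eq_zero_of_shellLower`, its shell-energy widening) are stated for
members exactly self-similar about the ORIGIN, because the energy drain was fed by the time-dependent
profile LEI of `…SelfSimilarLEI`.  With the test-function route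
(`EndpointFlux.shell_energy_le_flux_of_profileEE_half` ← profile local energy EQUALITY, delivered for
past-exact members by `Past.profileData_of_past`) the same strata hold for members exactly self-similar
about ANY `(T, x₀)` on a past sub-slab `τ < T₁` (`T₁ ≤ 0`, `T₁ ≤ T`), arbitrary on `[T₁, 0)`:

* `EndpointSpread.setIntegral_abs_le_of_lintegral_rpow` — Hölder on a ball: `∫_B |P| ≤ M^{2/3} |B|^{1/3}`
  when `∫_B ‖P‖^{3/2} ≤ M` (the unweighted large-scale `D`-growth replaces the weighted bound of the
  centred files);
* `EndpointSpread.selfSimilar_half_false_of_shellLower_past` — crux hypotheses verbatim at `ρ = 1/2`,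
  past-exact self-similarity about `(T, x₀)`, sublinear growth `‖V(y)‖ ≤ C_up|y|^{1−δ}` a.e. far out, and
  a shell lower bound `c₀ L^{−5+η} ≤ ∫_{L≤|y|<2L}‖V‖²` along radii beyond every bound ⇒ contradiction;
  `…ae_eq_zero_of_shellLower_past` the `Sig`-shaped form;
* `EndpointSpread.selfSimilar_half_ae_eq_zero_of_powerSpread_past` — the POWER-SPREAD stratum
  (`c₀|y|^{−(4−δ')} ≤ ‖V(y)‖ ≤ C_up|y|^{1−δ}` a.e. far out) for past-exact members: Chae–Shvydkoy's
  Thm 3.1 in the class about any space–time point.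

Inputs from `Past.profileData_of_past` (`ρ = 1/2`): `V ∈ L²` (large-scale `A`-growth `∫_{B_L}|V|² ≤ C`
for `L ≥ 2 − T₁`, exhausting `ℝ³`), `V ∈ L³_loc` (from `L⁶(B_r)`), `|P||V| ∈ L¹_loc` and `P ∈ L¹_loc`
(from `P ∈ L^{3/2}(B_r)`, Hölder), the weak Poisson equation, the growth `∫_{B_L}|P| ≲ L^{5/3}`
(large-scale `D`-growth + Hölder, threshold inflated to `L ≥ 1`), the Riesz representation at every
scale (`pressure_ae_eq_scaleQ_of_poisson`), and the profile energy equality.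

WHAT THIS IS NOT: not NS, not E, not the stubs — the past/shifted twin of one filled endpoint
stratum; the endpoint without a lower bound stays open. [cite: ChaeShvydkoy2013, §3.1 Thm. 3.1]
-/

noncomputable section

-- flat `Theorems/<Route><Decl>…` files of one crux share the namespace of the crux (tree convention)
set_option linter.dupNamespace false

open MeasureTheory Set Filter Topology Metric Function TopologicalSpace
open scoped ENNReal NNReal InnerProductSpace RealInnerProductSpace Laplacian

namespace Summit.NavierStokesRegularity.NavierStokesRegularity.Theorems.PowerGaugeEulerLiouville

open Literature.Analysis Literature.Analysis.FunctionSpaces Literature.Analysis.FluidPDE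

namespace EndpointSpread

section Tools

variable {V : EuclideanSpace ℝ (Fin 3) → EuclideanSpace ℝ (Fin 3)} {P : EuclideanSpace ℝ (Fin 3) → ℝ}

/-- **Hölder on a ball, `L^{3/2} ⊂ L¹`:** if `∫_{B_L} ‖P‖^{3/2} ≤ M < ∞` (in `ℝ≥0∞`) then
`∫_{B_L} |P| ≤ M^{2/3} · |B_L|^{1/3}`. [folklore] -/
theorem setIntegral_abs_le_of_lintegral_rpow (hPm : AEStronglyMeasurable P volume) {L : ℝ}
    {M : ℝ≥0∞} (hM : M ≠ ⊤)
    (hP : ∫⁻ y in ball (0 : EuclideanSpace ℝ (Fin 3)) L, ‖P y‖ₑ ^ (3 / 2 : ℝ) ≤ M) :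
    ∫ y in ball (0 : EuclideanSpace ℝ (Fin 3)) L, |P y| ≤
      M.toReal ^ (2 / 3 : ℝ) * (volume.real (ball (0 : EuclideanSpace ℝ (Fin 3)) L)) ^ (1 / 3 : ℝ) := by
  set μ : Measure (EuclideanSpace ℝ (Fin 3)) := volume.restrict (ball (0 : EuclideanSpace ℝ (Fin 3)) L)
    with hμ
  have hvol : μ Set.univ = volume (ball (0 : EuclideanSpace ℝ (Fin 3)) L) := by
    rw [hμ, Measure.restrict_apply_univ]
  set vB : ℝ≥0∞ := volume (ball (0 : EuclideanSpace ℝ (Fin 3)) L) with hvB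
  -- `eLpNorm' P 1 μ ≤ eLpNorm' P (3/2) μ · μ(univ)^{1/3}`
  have hcmp := eLpNorm'_le_eLpNorm'_mul_rpow_measure_univ (μ := μ) (f := P) one_pos
    (by norm_num : (1 : ℝ) ≤ 3 / 2) hPm.restrict
  rw [eLpNorm'_eq_lintegral_enorm, eLpNorm'_eq_lintegral_enorm, hvol] at hcmp
  have e1 : (1 : ℝ) / (3 / 2) = 2 / 3 := by norm_num
  simp only [ENNReal.rpow_one, e1, div_one] at hcmp
  rw [show (1 : ℝ) - 2 / 3 = 1 / 3 by norm_num] at hcmp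
  -- `hcmp : ∫⁻ ‖P‖ₑ ∂μ ≤ (∫⁻ ‖P‖ₑ^{3/2} ∂μ)^{2/3} * vB^{1/3}`
  have h1 : ∫⁻ y, ‖P y‖ₑ ∂μ ≤ M ^ (2 / 3 : ℝ) * vB ^ (1 / 3 : ℝ) := by
    refine hcmp.trans ?_
    gcongr
  have hfin : M ^ (2 / 3 : ℝ) * vB ^ (1 / 3 : ℝ) ≠ ⊤ :=
    ENNReal.mul_ne_top (ENNReal.rpow_ne_top_of_nonneg (by norm_num) hM)
      (ENNReal.rpow_ne_top_of_nonneg (by norm_num) measure_ball_lt_top.ne)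
  have h2 : ∫ y in ball (0 : EuclideanSpace ℝ (Fin 3)) L, |P y| = (∫⁻ y, ‖P y‖ₑ ∂μ).toReal := by
    rw [hμ, ← integral_norm_eq_lintegral_enorm hPm.restrict]
    rfl
  rw [h2]
  refine (ENNReal.toReal_mono hfin h1).trans (le_of_eq ?_)
  rw [ENNReal.toReal_mul, ← ENNReal.toReal_rpow, ← ENNReal.toReal_rpow]
  rfl

end Tools

section Member

/-- **No past-exact endpoint member with a sublinear profile whose shell energies are frequently
`≥ c₀ L^{−5+η}`.**  Crux hypotheses verbatim at `ρ = 1/2`; the member is exactly self-similar about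
`(T, x₀)` on the past sub-slab `τ < T₁` (`T₁ ≤ 0`, `T₁ ≤ T`; arbitrary on `[T₁, 0)`); its velocity profile
has sublinear growth `‖V(y)‖ ≤ C_up|y|^{1−δ}` a.e. for `|y| ≥ R₀` (`0 < δ ≤ 1`) and, for some `c₀, η > 0`
and radii beyond every bound, `c₀ L^{−5+η} ≤ ∫_{L≤|y|<2L}‖V‖²`.  Contradiction: the profile data of
`Past.profileData_of_past` feed `EndpointFlux.profile_false_half_of_shellLower_of_profileEE`.
[cite: ChaeShvydkoy2013, §3.1 Thm. 3.1] -/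
theorem selfSimilar_half_false_of_shellLower_past
    {T T₁ : ℝ} (hT₁ : T₁ ≤ 0) (hTT₁ : T₁ ≤ T) (x₀ : EuclideanSpace ℝ (Fin 3))
    {u : ℝ → EuclideanSpace ℝ (Fin 3) → EuclideanSpace ℝ (Fin 3)}
    {p : ℝ → EuclideanSpace ℝ (Fin 3) → ℝ}
    {H : ℝ → EuclideanSpace ℝ (Fin 3) → EuclideanSpace ℝ (Fin 3) →L[ℝ] EuclideanSpace ℝ (Fin 3)}
    {c : ℝ≥0} {V : EuclideanSpace ℝ (Fin 3) → EuclideanSpace ℝ (Fin 3)}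
    {P : EuclideanSpace ℝ (Fin 3) → ℝ}
    (hsw : IsSuitableWeakSolutionOn (slab (EuclideanSpace ℝ (Fin 3)) (Iio 0) isOpen_Iio) 0 0 u p)
    (hH : HasWeakSpatialGradientOn (slab (EuclideanSpace ℝ (Fin 3)) (Iio 0) isOpen_Iio) u H)
    (hgauge : ∀ a : ℝ, 0 < a →
      ENNReal.ofReal (a ^ (2 * (1 / 2 : ℝ))) * cknA a (0 : ℝ × EuclideanSpace ℝ (Fin 3)) u +
          ENNReal.ofReal (a ^ (1 / 2 : ℝ)) * cknE a (0 : ℝ × EuclideanSpace ℝ (Fin 3)) H +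
        ENNReal.ofReal (a ^ (2 * (1 / 2 : ℝ))) * cknD a (0 : ℝ × EuclideanSpace ℝ (Fin 3)) p ≤
          (c : ℝ≥0∞))
    (hu : ∀ τ : ℝ, τ < T₁ → u τ = fun x =>
      selfSimilarCollapse (1 / (2 + (1 / 2 : ℝ))) T V τ (x - x₀))
    (hp : ∀ τ : ℝ, τ < T₁ → p τ = fun x =>
      selfSimilarCollapsePressure (1 / (2 + (1 / 2 : ℝ))) T P τ (x - x₀))
    {δ Cup R₀ : ℝ} (hδ : 0 < δ) (hδ1 : δ ≤ 1) (hCup : 0 ≤ Cup)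
    (hup : ∀ᵐ y ∂volume, R₀ ≤ ‖y‖ → ‖V y‖ ≤ Cup * ‖y‖ ^ (1 - δ))
    {c₀ η : ℝ} (hc₀ : 0 < c₀) (hη : 0 < η)
    (hlow : ∀ L₁ : ℝ, ∃ L : ℝ, L₁ ≤ L ∧
      c₀ * L ^ (-(5 : ℝ) + η) ≤
        ∫ y in {y : EuclideanSpace ℝ (Fin 3) | L ≤ ‖y‖ ∧ ‖y‖ < 2 * L}, ‖V y‖ ^ 2) : False := by
  -- the three gauges separately
  have hA : ∀ a : ℝ, 0 < a → ENNReal.ofReal (a ^ (2 * (1 / 2 : ℝ))) *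
      cknA a (0 : ℝ × EuclideanSpace ℝ (Fin 3)) u ≤ (c : ℝ≥0∞) :=
    fun a ha => le_trans (le_trans le_self_add le_self_add) (hgauge a ha)
  have hE : ∀ a : ℝ, 0 < a → ENNReal.ofReal (a ^ (1 / 2 : ℝ)) *
      cknE a (0 : ℝ × EuclideanSpace ℝ (Fin 3)) H ≤ (c : ℝ≥0∞) :=
    fun a ha => le_trans (le_trans le_add_self le_self_add) (hgauge a ha)
  have hD : ∀ a : ℝ, 0 < a → ENNReal.ofReal (a ^ (2 * (1 / 2 : ℝ))) *
      cknD a (0 : ℝ × EuclideanSpace ℝ (Fin 3)) p ≤ (c : ℝ≥0∞) :=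
    fun a ha => le_trans le_add_self (hgauge a ha)
  -- the past profile data at `ρ = 1/2`
  obtain ⟨G, hVm, hPm, -, hVG, -, ⟨CA, hCAtop, hA₁⟩, -, ⟨CD, hCDtop, hD₁⟩, hV6, -, hP32, -, -,
    hPoisson, hEE⟩ :=
    Past.profileData_of_past (ρ := 1 / 2) (by norm_num) (by norm_num) hT₁ hTT₁ x₀
      hsw.distributional hH hA hE hD hu hp
  set L₀ : ℝ := 2 - T₁ with hL₀
  have hL₀2 : 2 ≤ L₀ := by rw [hL₀]; linarith
  have hL₀0 : 0 < L₀ := by linarith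
  -- `V ∈ L²` : the large-scale `A`-growth at the endpoint reads `∫_{B_L}|V|² ≤ CA` for `L ≥ L₀`
  have hV2l : ∫⁻ y, ‖V y‖ₑ ^ 2 ≤ CA := by
    -- adapted from the tree's `lintegral_enorm_sq_profile_le_of_half`
    have hU : (⋃ n : ℕ, ball (0 : EuclideanSpace ℝ (Fin 3)) ((n : ℝ) + L₀)) = univ := by
      refine eq_univ_of_forall fun y => mem_iUnion.2 ?_
      obtain ⟨n, hn⟩ := exists_nat_gt ‖y‖
      exact ⟨n, by rw [mem_ball_zero_iff]; linarith⟩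
    have hdir : Directed (· ⊆ ·) fun n : ℕ => ball (0 : EuclideanSpace ℝ (Fin 3)) ((n : ℝ) + L₀) :=
      Monotone.directed_le fun m n hmn => ball_subset_ball (by
        have : (m : ℝ) ≤ n := Nat.cast_le.2 hmn
        linarith)
    rw [← setLIntegral_univ, ← hU, setLIntegral_iUnion_of_directed _ hdir]
    refine iSup_le fun n => ?_
    have h := hA₁ ((n : ℝ) + L₀) (by rw [hL₀]; linarith [Nat.cast_nonneg (α := ℝ) n])
    refine h.trans (le_of_eq ?_)
    norm_num
  have hV2 : Integrable (fun y => ‖V y‖ ^ 2) volume :=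
    integrable_norm_sq_of_lintegral_lt_top hVm (lt_of_le_of_lt hV2l hCAtop.lt_top)
  -- `V ∈ L³_loc` (from `L⁶` on balls) and `|P||V| ∈ L¹_loc`, `P ∈ L¹_loc` (from `L^{3/2}` on balls)
  have hV3B : ∀ r : ℝ, MemLp V 3 (volume.restrict (ball (0 : EuclideanSpace ℝ (Fin 3)) r)) := by
    intro r
    haveI : IsFiniteMeasure (volume.restrict (ball (0 : EuclideanSpace ℝ (Fin 3)) r)) :=
      isFiniteMeasure_restrict.2 measure_ball_lt_top.ne
    exact (hV6 r).mono_exponent (by norm_num)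
  have hV3 : LocallyIntegrable (fun y => ‖V y‖ ^ 3) volume := by
    intro x
    refine ⟨ball 0 (‖x‖ + 1), isOpen_ball.mem_nhds (by rw [mem_ball, dist_zero_right]; linarith), ?_⟩
    exact (hV3B (‖x‖ + 1)).integrable_norm_pow (by norm_num)
  have hPVB : ∀ r : ℝ, IntegrableOn (fun x => |P x| * ‖V x‖) (ball (0 : EuclideanSpace ℝ (Fin 3)) r) volume := by
    -- adapted from `ProfileEnergy.profile_local_energy_equality` (Hölder `(3/2, 3, 1)`)
    intro r
    haveI : ENNReal.HolderTriple (3 / 2 : ℝ≥0∞) 3 1 := by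
      refine ⟨?_⟩
      rw [ENNReal.inv_div (Or.inr (by norm_num)) (Or.inr (by norm_num)), inv_one]
      have e3 : (3 : ℝ≥0∞)⁻¹ = ((3⁻¹ : ℝ≥0) : ℝ≥0∞) := by rw [ENNReal.coe_inv (by norm_num)]; norm_num
      have e23 : (2 / 3 : ℝ≥0∞) = ((2 / 3 : ℝ≥0) : ℝ≥0∞) := by rw [ENNReal.coe_div (by norm_num)]; norm_num
      rw [e3, e23, ← ENNReal.coe_add, ← ENNReal.coe_one, ENNReal.coe_inj]
      norm_num
    have h1 : MemLp (fun x => |P x|) (3 / 2 : ℝ≥0∞) (volume.restrict (ball (0 : EuclideanSpace ℝ (Fin 3)) r)) :=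
      (hP32 r).abs
    have h2 : MemLp (fun x => ‖V x‖) 3 (volume.restrict (ball (0 : EuclideanSpace ℝ (Fin 3)) r)) :=
      (hV3B r).norm
    have h3 : MemLp (fun x => |P x| * ‖V x‖) 1 (volume.restrict (ball (0 : EuclideanSpace ℝ (Fin 3)) r)) := by
      have := MemLp.mul (p := (3 / 2 : ℝ≥0∞)) (q := 3) (r := 1) h2 h1
      simpa [Pi.mul_def, mul_comm] using this
    exact memLp_one_iff_integrable.1 h3
  have hPV : LocallyIntegrable (fun y => |P y| * ‖V y‖) volume := by
    intro x
    exact ⟨ball 0 (‖x‖ + 1), isOpen_ball.mem_nhds (by rw [mem_ball, dist_zero_right]; linarith),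
      hPVB (‖x‖ + 1)⟩
  have hP1 : LocallyIntegrable P volume := by
    intro x
    refine ⟨ball 0 (‖x‖ + 1), isOpen_ball.mem_nhds (by rw [mem_ball, dist_zero_right]; linarith), ?_⟩
    haveI : IsFiniteMeasure (volume.restrict (ball (0 : EuclideanSpace ℝ (Fin 3)) (‖x‖ + 1))) :=
      isFiniteMeasure_restrict.2 measure_ball_lt_top.ne
    have h32 : (1 : ℝ≥0∞) ≤ 3 / 2 := by
      rw [ENNReal.le_div_iff_mul_le (Or.inl two_ne_zero) (Or.inl ENNReal.ofNat_ne_top)]; norm_num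
    exact (hP32 (‖x‖ + 1)).integrable h32
  -- the growth `∫_{B_L} |P| ≤ AP L^{5/3}` for `L ≥ 1` (large-scale `D`-growth + Hölder, threshold inflated)
  set v₁ : ℝ := volume.real (ball (0 : EuclideanSpace ℝ (Fin 3)) 1) with hv₁
  have hv₁0 : 0 ≤ v₁ := measureReal_nonneg
  set AP : ℝ := (CD * ENNReal.ofReal L₀).toReal ^ (2 / 3 : ℝ) *
    (volume.real (ball (0 : EuclideanSpace ℝ (Fin 3)) L₀)) ^ (1 / 3 : ℝ) * L₀ ^ (5 / 3 : ℝ) +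
    (CD.toReal ^ (2 / 3 : ℝ) * v₁ ^ (1 / 3 : ℝ)) with hAP
  have hAP0 : 0 ≤ AP := by positivity
  have hPg : ∀ L : ℝ, 1 ≤ L → ∫ y in ball (0 : EuclideanSpace ℝ (Fin 3)) L, |P y| ≤ AP * L ^ (3 - (4 / 3 : ℝ)) := by
    intro L hL
    have hL0 : 0 < L := by linarith
    rw [show (3 : ℝ) - 4 / 3 = 5 / 3 by norm_num]
    by_cases hLL₀ : L₀ ≤ L
    · -- large scales: `∫⁻_{B_L} ‖P‖ₑ^{3/2} ≤ CD · L`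
      have hDL : ∫⁻ y in ball (0 : EuclideanSpace ℝ (Fin 3)) L, ‖P y‖ₑ ^ (3 / 2 : ℝ) ≤ CD * ENNReal.ofReal L := by
        refine (hD₁ L hLL₀).trans (le_of_eq ?_)
        norm_num
      have h := setIntegral_abs_le_of_lintegral_rpow hPm (ENNReal.mul_ne_top hCDtop ENNReal.ofReal_ne_top) hDL
      refine h.trans ?_
      have f1 : (CD * ENNReal.ofReal L).toReal = CD.toReal * L := by
        rw [ENNReal.toReal_mul, ENNReal.toReal_ofReal hL0.le]
      have f2 : volume.real (ball (0 : EuclideanSpace ℝ (Fin 3)) L) = L ^ 3 * v₁ := by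
        rw [← Measure.addHaar_real_closedBall_eq_addHaar_real_ball,
          Measure.addHaar_real_closedBall _ _ hL0.le, finrank_euclideanSpace_fin]
      have f3 : (L ^ 3 * v₁) ^ (1 / 3 : ℝ) = L * v₁ ^ (1 / 3 : ℝ) := by
        rw [Real.mul_rpow (by positivity) hv₁0, ← Real.rpow_natCast L 3, ← Real.rpow_mul hL0.le]
        norm_num
      have f4 : (CD.toReal * L) ^ (2 / 3 : ℝ) = CD.toReal ^ (2 / 3 : ℝ) * L ^ (2 / 3 : ℝ) :=
        Real.mul_rpow ENNReal.toReal_nonneg hL0.le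
      have f5 : L ^ (5 / 3 : ℝ) = L ^ (2 / 3 : ℝ) * L := by
        rw [show (5 / 3 : ℝ) = 2 / 3 + 1 by norm_num, Real.rpow_add hL0, Real.rpow_one]
      rw [f1, f2, f3, f4, f5]
      have hle : CD.toReal ^ (2 / 3 : ℝ) * v₁ ^ (1 / 3 : ℝ) ≤ AP := by
        rw [hAP]; exact le_add_of_nonneg_left (by positivity)
      calc CD.toReal ^ (2 / 3 : ℝ) * L ^ (2 / 3 : ℝ) * (L * v₁ ^ (1 / 3 : ℝ))
          = (CD.toReal ^ (2 / 3 : ℝ) * v₁ ^ (1 / 3 : ℝ)) * (L ^ (2 / 3 : ℝ) * L) := by ring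
        _ ≤ AP * (L ^ (2 / 3 : ℝ) * L) := mul_le_mul_of_nonneg_right hle (by positivity)
    · -- small scales `1 ≤ L < L₀`: bound by the value at `L₀`, times `L^{5/3} ≥ 1`
      rw [not_le] at hLL₀
      have hDL₀ : ∫⁻ y in ball (0 : EuclideanSpace ℝ (Fin 3)) L₀, ‖P y‖ₑ ^ (3 / 2 : ℝ) ≤ CD * ENNReal.ofReal L₀ := by
        refine (hD₁ L₀ le_rfl).trans (le_of_eq ?_)
        norm_num
      have h := setIntegral_abs_le_of_lintegral_rpow hPm (ENNReal.mul_ne_top hCDtop ENNReal.ofReal_ne_top) hDL₀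
      have hmono : ∫ y in ball (0 : EuclideanSpace ℝ (Fin 3)) L, |P y| ≤
          ∫ y in ball (0 : EuclideanSpace ℝ (Fin 3)) L₀, |P y| :=
        setIntegral_mono_set ((hP1.integrableOn_isCompact (isCompact_closedBall 0 L₀)).mono_set
          ball_subset_closedBall |>.abs) (Eventually.of_forall fun y => abs_nonneg _)
          (ball_subset_ball hLL₀.le).eventuallyLE
      refine hmono.trans (h.trans ?_)
      have h1 : (1 : ℝ) ≤ L ^ (5 / 3 : ℝ) := Real.one_le_rpow hL (by norm_num)
      calc (CD * ENNReal.ofReal L₀).toReal ^ (2 / 3 : ℝ) *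
            volume.real (ball (0 : EuclideanSpace ℝ (Fin 3)) L₀) ^ (1 / 3 : ℝ)
          = (CD * ENNReal.ofReal L₀).toReal ^ (2 / 3 : ℝ) *
              volume.real (ball (0 : EuclideanSpace ℝ (Fin 3)) L₀) ^ (1 / 3 : ℝ) * 1 := (mul_one _).symm
        _ ≤ (CD * ENNReal.ofReal L₀).toReal ^ (2 / 3 : ℝ) *
              volume.real (ball (0 : EuclideanSpace ℝ (Fin 3)) L₀) ^ (1 / 3 : ℝ) * L₀ ^ (5 / 3 : ℝ) * L ^ (5 / 3 : ℝ) := by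
            rw [mul_assoc _ (L₀ ^ (5 / 3 : ℝ))]
            refine mul_le_mul_of_nonneg_left ?_ (by positivity)
            exact one_le_mul_of_one_le_of_one_le (Real.one_le_rpow (by linarith) (by norm_num)) h1
        _ ≤ AP * L ^ (5 / 3 : ℝ) := by
            refine mul_le_mul_of_nonneg_right ?_ (by positivity)
            rw [hAP]
            exact le_add_of_nonneg_right (by positivity)
  -- the growth of `∫_{B_L} ‖V‖³`
  set AV : ℝ := (∫ y in closedBall (0 : EuclideanSpace ℝ (Fin 3)) |R₀|, ‖V y‖ ^ 3) +
    Cup * ∫ z, ‖V z‖ ^ 2 with hAV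
  have hAV0 : 0 ≤ AV := add_nonneg (setIntegral_nonneg measurableSet_closedBall fun y _ => by positivity)
    (mul_nonneg hCup (integral_nonneg fun z => by positivity))
  have hPg' : ∀ L : ℝ, 1 ≤ L → ∫ y in ball (0 : EuclideanSpace ℝ (Fin 3)) L, |P y| ≤
      max AP AV * L ^ (3 - (4 / 3 : ℝ)) := fun L hL =>
    (hPg L hL).trans (mul_le_mul_of_nonneg_right (le_max_left _ _) (by positivity))
  have hVg : ∀ L : ℝ, 1 ≤ L → ∫ y in ball (0 : EuclideanSpace ℝ (Fin 3)) L, ‖V y‖ ^ 3 ≤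
      max AP AV * L ^ (3 - (4 / 3 : ℝ)) := by
    intro L hL
    rw [show (3 : ℝ) - 4 / 3 = 5 / 3 by norm_num]
    exact (setIntegral_cube_le_of_sublinear hV2 hV3 hδ1 (by linarith) hCup hup hL).trans
      (mul_le_mul_of_nonneg_right (le_max_right _ _) (by positivity))
  -- the Riesz representation at every scale
  have hPR : ∀ R : ℝ, 1 ≤ R → ∀ᵐ y ∂volume, ‖y‖ < R / 2 →
      P y = rieszPressure ((ball (0 : EuclideanSpace ℝ (Fin 3)) R).indicator V) y +
        ∫ z in {z | R ≤ ‖z‖}, pressureKernel (y - z) (V z) :=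
    fun R hR => pressure_ae_eq_scaleQ_of_poisson hVm hV2 hV3 hP1 hPoisson (σ := 4 / 3)
      (by norm_num) (by norm_num) (le_max_of_le_left hAP0) hPg' hVg (by linarith)
  exact EndpointFlux.profile_false_half_of_shellLower_of_profileEE hVm hV2 hV3 hPV
    (by norm_num : (1 / (2 + (1 / 2 : ℝ)) : ℝ) = 2 / 5) hEE hPR hδ hδ1 hCup hup hc₀ hη hlow

/-- **The shell-lower stratum for past-exact endpoint members, `Sig`-shaped**: vacuously trivial.
[cite: ChaeShvydkoy2013, §3.1 Thm. 3.1] -/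
theorem selfSimilar_half_ae_eq_zero_of_shellLower_past
    {T T₁ : ℝ} (hT₁ : T₁ ≤ 0) (hTT₁ : T₁ ≤ T) (x₀ : EuclideanSpace ℝ (Fin 3))
    {u : ℝ → EuclideanSpace ℝ (Fin 3) → EuclideanSpace ℝ (Fin 3)}
    {p : ℝ → EuclideanSpace ℝ (Fin 3) → ℝ}
    {H : ℝ → EuclideanSpace ℝ (Fin 3) → EuclideanSpace ℝ (Fin 3) →L[ℝ] EuclideanSpace ℝ (Fin 3)}
    {c : ℝ≥0} {V : EuclideanSpace ℝ (Fin 3) → EuclideanSpace ℝ (Fin 3)}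
    {P : EuclideanSpace ℝ (Fin 3) → ℝ}
    (hsw : IsSuitableWeakSolutionOn (slab (EuclideanSpace ℝ (Fin 3)) (Iio 0) isOpen_Iio) 0 0 u p)
    (hH : HasWeakSpatialGradientOn (slab (EuclideanSpace ℝ (Fin 3)) (Iio 0) isOpen_Iio) u H)
    (hgauge : ∀ a : ℝ, 0 < a →
      ENNReal.ofReal (a ^ (2 * (1 / 2 : ℝ))) * cknA a (0 : ℝ × EuclideanSpace ℝ (Fin 3)) u +
          ENNReal.ofReal (a ^ (1 / 2 : ℝ)) * cknE a (0 : ℝ × EuclideanSpace ℝ (Fin 3)) H +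
        ENNReal.ofReal (a ^ (2 * (1 / 2 : ℝ))) * cknD a (0 : ℝ × EuclideanSpace ℝ (Fin 3)) p ≤
          (c : ℝ≥0∞))
    (hu : ∀ τ : ℝ, τ < T₁ → u τ = fun x =>
      selfSimilarCollapse (1 / (2 + (1 / 2 : ℝ))) T V τ (x - x₀))
    (hp : ∀ τ : ℝ, τ < T₁ → p τ = fun x =>
      selfSimilarCollapsePressure (1 / (2 + (1 / 2 : ℝ))) T P τ (x - x₀))
    {δ Cup R₀ : ℝ} (hδ : 0 < δ) (hδ1 : δ ≤ 1) (hCup : 0 ≤ Cup)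
    (hup : ∀ᵐ y ∂volume, R₀ ≤ ‖y‖ → ‖V y‖ ≤ Cup * ‖y‖ ^ (1 - δ))
    {c₀ η : ℝ} (hc₀ : 0 < c₀) (hη : 0 < η)
    (hlow : ∀ L₁ : ℝ, ∃ L : ℝ, L₁ ≤ L ∧
      c₀ * L ^ (-(5 : ℝ) + η) ≤
        ∫ y in {y : EuclideanSpace ℝ (Fin 3) | L ≤ ‖y‖ ∧ ‖y‖ < 2 * L}, ‖V y‖ ^ 2) :
    uncurry u =ᵐ[volume.restrict (Iio (0 : ℝ) ×ˢ (univ : Set (EuclideanSpace ℝ (Fin 3))))] 0 :=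
  (selfSimilar_half_false_of_shellLower_past hT₁ hTT₁ x₀ hsw hH hgauge hu hp hδ hδ1 hCup hup hc₀ hη
    hlow).elim

/-- **Chae–Shvydkoy's Thm 3.1 in the class about any space–time point** (past-exact members): crux
hypotheses verbatim at `ρ = 1/2`, exact self-similarity about `(T, x₀)` for `τ < T₁`, and the POWER
SPREAD `c₀|y|^{−(4−δ')} ≤ ‖V(y)‖ ≤ C_up|y|^{1−δ}` a.e. far out ⇒ the member is trivial (vacuously): the
pointwise lower bound gives the shell lower bound (`shellLower_of_powerLower`, with `V ∈ L²` from the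
large-scale `A`-growth). [cite: ChaeShvydkoy2013, §3.1 Thm. 3.1] -/
theorem selfSimilar_half_ae_eq_zero_of_powerSpread_past
    {T T₁ : ℝ} (hT₁ : T₁ ≤ 0) (hTT₁ : T₁ ≤ T) (x₀ : EuclideanSpace ℝ (Fin 3))
    {u : ℝ → EuclideanSpace ℝ (Fin 3) → EuclideanSpace ℝ (Fin 3)}
    {p : ℝ → EuclideanSpace ℝ (Fin 3) → ℝ}
    {H : ℝ → EuclideanSpace ℝ (Fin 3) → EuclideanSpace ℝ (Fin 3) →L[ℝ] EuclideanSpace ℝ (Fin 3)}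
    {c : ℝ≥0} {V : EuclideanSpace ℝ (Fin 3) → EuclideanSpace ℝ (Fin 3)}
    {P : EuclideanSpace ℝ (Fin 3) → ℝ}
    (hsw : IsSuitableWeakSolutionOn (slab (EuclideanSpace ℝ (Fin 3)) (Iio 0) isOpen_Iio) 0 0 u p)
    (hH : HasWeakSpatialGradientOn (slab (EuclideanSpace ℝ (Fin 3)) (Iio 0) isOpen_Iio) u H)
    (hgauge : ∀ a : ℝ, 0 < a →
      ENNReal.ofReal (a ^ (2 * (1 / 2 : ℝ))) * cknA a (0 : ℝ × EuclideanSpace ℝ (Fin 3)) u +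
          ENNReal.ofReal (a ^ (1 / 2 : ℝ)) * cknE a (0 : ℝ × EuclideanSpace ℝ (Fin 3)) H +
        ENNReal.ofReal (a ^ (2 * (1 / 2 : ℝ))) * cknD a (0 : ℝ × EuclideanSpace ℝ (Fin 3)) p ≤
          (c : ℝ≥0∞))
    (hu : ∀ τ : ℝ, τ < T₁ → u τ = fun x =>
      selfSimilarCollapse (1 / (2 + (1 / 2 : ℝ))) T V τ (x - x₀))
    (hp : ∀ τ : ℝ, τ < T₁ → p τ = fun x =>
      selfSimilarCollapsePressure (1 / (2 + (1 / 2 : ℝ))) T P τ (x - x₀))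
    {δ Cup R₀ : ℝ} (hδ : 0 < δ) (hδ1 : δ ≤ 1) (hCup : 0 ≤ Cup)
    (hup : ∀ᵐ y ∂volume, R₀ ≤ ‖y‖ → ‖V y‖ ≤ Cup * ‖y‖ ^ (1 - δ))
    {c₀ δ' R₀' : ℝ} (hc₀ : 0 < c₀) (hδ' : 0 < δ')
    (hlow : ∀ᵐ y ∂volume, R₀' ≤ ‖y‖ → c₀ * ‖y‖ ^ (-(4 - δ')) ≤ ‖V y‖) :
    uncurry u =ᵐ[volume.restrict (Iio (0 : ℝ) ×ˢ (univ : Set (EuclideanSpace ℝ (Fin 3))))] 0 := by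
  -- `V ∈ L²` from the large-scale `A`-growth (as in `selfSimilar_half_false_of_shellLower_past`)
  have hA : ∀ a : ℝ, 0 < a → ENNReal.ofReal (a ^ (2 * (1 / 2 : ℝ))) *
      cknA a (0 : ℝ × EuclideanSpace ℝ (Fin 3)) u ≤ (c : ℝ≥0∞) :=
    fun a ha => le_trans (le_trans le_self_add le_self_add) (hgauge a ha)
  have hE : ∀ a : ℝ, 0 < a → ENNReal.ofReal (a ^ (1 / 2 : ℝ)) *
      cknE a (0 : ℝ × EuclideanSpace ℝ (Fin 3)) H ≤ (c : ℝ≥0∞) :=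
    fun a ha => le_trans (le_trans le_add_self le_self_add) (hgauge a ha)
  have hD : ∀ a : ℝ, 0 < a → ENNReal.ofReal (a ^ (2 * (1 / 2 : ℝ))) *
      cknD a (0 : ℝ × EuclideanSpace ℝ (Fin 3)) p ≤ (c : ℝ≥0∞) :=
    fun a ha => le_trans le_add_self (hgauge a ha)
  obtain ⟨G, hVm, -, -, -, -, ⟨CA, hCAtop, hA₁⟩, -⟩ :=
    Past.profileData_of_past (ρ := 1 / 2) (by norm_num) (by norm_num) hT₁ hTT₁ x₀
      hsw.distributional hH hA hE hD hu hp
  set L₀ : ℝ := 2 - T₁ with hL₀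
  have hV2l : ∫⁻ y, ‖V y‖ₑ ^ 2 ≤ CA := by
    have hU : (⋃ n : ℕ, ball (0 : EuclideanSpace ℝ (Fin 3)) ((n : ℝ) + L₀)) = univ := by
      refine eq_univ_of_forall fun y => mem_iUnion.2 ?_
      obtain ⟨n, hn⟩ := exists_nat_gt ‖y‖
      exact ⟨n, by rw [mem_ball_zero_iff]; linarith⟩
    have hdir : Directed (· ⊆ ·) fun n : ℕ => ball (0 : EuclideanSpace ℝ (Fin 3)) ((n : ℝ) + L₀) :=
      Monotone.directed_le fun m n hmn => ball_subset_ball (by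
        have : (m : ℝ) ≤ n := Nat.cast_le.2 hmn
        linarith)
    rw [← setLIntegral_univ, ← hU, setLIntegral_iUnion_of_directed _ hdir]
    refine iSup_le fun n => ?_
    have h := hA₁ ((n : ℝ) + L₀) (by rw [hL₀]; linarith [Nat.cast_nonneg (α := ℝ) n])
    refine h.trans (le_of_eq ?_)
    norm_num
  have hV2 : Integrable (fun y => ‖V y‖ ^ 2) volume :=
    integrable_norm_sq_of_lintegral_lt_top hVm (lt_of_le_of_lt hV2l hCAtop.lt_top)
  obtain ⟨c₁, η, hc₁, hη, hshell⟩ := shellLower_of_powerLower hV2 hc₀ hδ' hlow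
  exact selfSimilar_half_ae_eq_zero_of_shellLower_past hT₁ hTT₁ x₀ hsw hH hgauge hu hp hδ hδ1 hCup hup
    hc₁ hη fun L₁ => ⟨max L₁ (max R₀' 1), le_max_left _ _, hshell _ (le_max_right _ _)⟩

end Member

end EndpointSpread

end Summit.NavierStokesRegularity.NavierStokesRegularity.Theorems.PowerGaugeEulerLiouville

end
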